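import Literature.NumberTheory.EllipticCurves.BinaryQuarticTwoCoveringsSurjSetup
import HarnessLib

/-!
# Two-coverings attached to binary quartic forms, IX: local isotropy of the conic

Topic `Literature/NumberTheory/EllipticCurves`. Ninth file of the theory proving the named fact
`Literature.NumberTheory.EllipticCurves.bhargavaShankar_card_selmerTwo_eq_kEquivClassCount`.
For a cocycle `φ : Γ_ℚ → E_{A,B}[2]` whose class satisfies the local (Selmer) condition at a
`ℚ`-field `E` (a completion `ℚ_v`) possessing a few rational points, the rational conic
`q_φ(u) = Σᵢ δᵢ (u₀ + u₁eᵢ + u₂eᵢ²)² / F′(eᵢ)` of file VIII represents zero over `E`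
(Birch–Swinnerton-Dyer 1963, Lemma 1 / Cremona 2001 §5: "if `ξ` is trivial in
`H¹(Gal(K̄/K), E)` then the conic has a point"): the local point `P` with `σP − P = φ(σ)` gives,
through the `2`-descent functions `gᵢ(P)` (`gᵢ² = x(2P) − eᵢ`, `gᵢ(P + T) = ±gᵢ(P)`), a vector
with the same twisted Galois behaviour as the invariant `w`, whence a `Γ_E`-fixed (i.e. `E`-rational)
isotropic vector `u = g(P)/w` of `q_φ`, using `Σᵢ (X − eᵢ)/F′(eᵢ) = 0`.

* `§1` partial fractions and Lagrange interpolation at the roots of `X³ + AX + B`;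
* `§2` short-model helpers (nonsingularity for `y ≠ 0`; points with `y = 0` are `2`-torsion);
* `§3` the local picture: images of `eᵢ`, `w`, the torsors; the local point `P`;
* `§4` the transformation laws of `gᵢ(P)` and `w` under `Γ_E`, the fixed ratios;
* `§5` the `E`-rational isotropic vector: `RepresentsZero (Q.map (algebraMap ℚ E))`.

## References

* B. J. Birch, H. P. F. Swinnerton-Dyer, *Notes on elliptic curves. I*, J. reine angew. Math. 212
  (1963), Lemma 1. [BirchSwinnertonDyer1963]
* J. E. Cremona, *Classical invariants and 2-descent on elliptic curves*, J. Symbolic Comput. 31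
  (2001), §5. [Cremona2001]
* M. Bhargava, A. Shankar, Ann. of Math. (2) 181 (2015), Lemma 5.2 (arXiv:1006.1002v2 numbering).
  [BhargavaShankarAnnals2015]
-/

noncomputable section

open scoped Classical

universe u

namespace Literature.NumberTheory.EllipticCurves

namespace TwoCovering

open BinaryQuartic WeierstrassCurve WeierstrassCurve.Affine GaloisRepresentations
open Literature.NumberTheory.QuadraticForms

/-! ## §1 Partial fractions and Lagrange interpolation -/

section Lagrange

variable {F : Type*} [Field F]

/-- `F′(eᵢ) = 3eᵢ² + A = (eᵢ − eⱼ)(eᵢ − e_k)` for the three roots (Vieta). [folklore] -/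
theorem deriv_factor {e₁ e₂ e₃ A : F} (hs : e₁ + e₂ + e₃ = 0) (hA : A = e₁ * e₂ + e₁ * e₃ + e₂ * e₃) :
    3 * e₁ ^ 2 + A = (e₁ - e₂) * (e₁ - e₃) ∧ 3 * e₂ ^ 2 + A = (e₂ - e₁) * (e₂ - e₃) ∧
      3 * e₃ ^ 2 + A = (e₃ - e₁) * (e₃ - e₂) := by
  refine ⟨?_, ?_, ?_⟩ <;> rw [hA]
  · linear_combination (2 * e₁) * hs
  · linear_combination (2 * e₂) * hs
  · linear_combination (2 * e₃) * hs

/-- **Partial fractions**: `Σᵢ (X − eᵢ)/F′(eᵢ) = 0` for the three distinct roots of `X³ + AX + B`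
(i.e. `Σ 1/F′(eᵢ) = Σ eᵢ/F′(eᵢ) = 0`). [folklore] -/
theorem sum_sub_div_deriv_eq_zero {e₁ e₂ e₃ A X : F} (hs : e₁ + e₂ + e₃ = 0)
    (hA : A = e₁ * e₂ + e₁ * e₃ + e₂ * e₃) (h12 : e₁ - e₂ ≠ 0) (h13 : e₁ - e₃ ≠ 0) (h23 : e₂ - e₃ ≠ 0) :
    (X - e₁) / (3 * e₁ ^ 2 + A) + (X - e₂) / (3 * e₂ ^ 2 + A) + (X - e₃) / (3 * e₃ ^ 2 + A) = 0 := by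
  obtain ⟨h1, h2, h3⟩ := deriv_factor hs hA
  rw [h1, h2, h3]
  have h21 : e₂ - e₁ ≠ 0 := fun h ↦ h12 (by linear_combination -h)
  have h31 : e₃ - e₁ ≠ 0 := fun h ↦ h13 (by linear_combination -h)
  have h32 : e₃ - e₂ ≠ 0 := fun h ↦ h23 (by linear_combination -h)
  rw [div_add_div _ _ (mul_ne_zero h12 h13) (mul_ne_zero h21 h23), div_add_div _ _
    (mul_ne_zero (mul_ne_zero h12 h13) (mul_ne_zero h21 h23)) (mul_ne_zero h31 h32), div_eq_zero_iff]
  left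
  ring

/-- **Lagrange interpolation at the roots**: with `a = Σ ρⱼ(A + eⱼ²)/F′(eⱼ)`,
`b = Σ ρⱼeⱼ/F′(eⱼ)`, `c = Σ ρⱼ/F′(eⱼ)` one has `a + b eᵢ + c eᵢ² = ρᵢ` (`i = 1, 2, 3`).
[folklore] -/
theorem lagrange_interpolate {e₁ e₂ e₃ A ρ₁ ρ₂ ρ₃ : F} (hs : e₁ + e₂ + e₃ = 0)
    (hA : A = e₁ * e₂ + e₁ * e₃ + e₂ * e₃) (h12 : e₁ - e₂ ≠ 0) (h13 : e₁ - e₃ ≠ 0) (h23 : e₂ - e₃ ≠ 0) :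
    let a := ρ₁ * (A + e₁ ^ 2) / (3 * e₁ ^ 2 + A) + ρ₂ * (A + e₂ ^ 2) / (3 * e₂ ^ 2 + A) +
      ρ₃ * (A + e₃ ^ 2) / (3 * e₃ ^ 2 + A)
    let b := ρ₁ * e₁ / (3 * e₁ ^ 2 + A) + ρ₂ * e₂ / (3 * e₂ ^ 2 + A) + ρ₃ * e₃ / (3 * e₃ ^ 2 + A)
    let c := ρ₁ / (3 * e₁ ^ 2 + A) + ρ₂ / (3 * e₂ ^ 2 + A) + ρ₃ / (3 * e₃ ^ 2 + A)
    a + b * e₁ + c * e₁ ^ 2 = ρ₁ ∧ a + b * e₂ + c * e₂ ^ 2 = ρ₂ ∧ a + b * e₃ + c * e₃ ^ 2 = ρ₃ := by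
  intro a b c
  obtain ⟨h1, h2, h3⟩ := deriv_factor hs hA
  have h21 : e₂ - e₁ ≠ 0 := fun h ↦ h12 (by linear_combination -h)
  have h31 : e₃ - e₁ ≠ 0 := fun h ↦ h13 (by linear_combination -h)
  have h32 : e₃ - e₂ ≠ 0 := fun h ↦ h23 (by linear_combination -h)
  have hF1 : 3 * e₁ ^ 2 + A ≠ 0 := by rw [h1]; exact mul_ne_zero h12 h13
  have hF2 : 3 * e₂ ^ 2 + A ≠ 0 := by rw [h2]; exact mul_ne_zero h21 h23
  have hF3 : 3 * e₃ ^ 2 + A ≠ 0 := by rw [h3]; exact mul_ne_zero h31 h32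
  have key : ∀ x : F, a + b * x + c * x ^ 2 = ρ₁ * (A + e₁ ^ 2 + e₁ * x + x ^ 2) / (3 * e₁ ^ 2 + A) +
      ρ₂ * (A + e₂ ^ 2 + e₂ * x + x ^ 2) / (3 * e₂ ^ 2 + A) +
      ρ₃ * (A + e₃ ^ 2 + e₃ * x + x ^ 2) / (3 * e₃ ^ 2 + A) := by
    intro x; simp only [a, b, c]; ring
  have v12 : A + e₁ ^ 2 + e₁ * e₂ + e₂ ^ 2 = 0 := by rw [hA]; linear_combination (e₁ + e₂) * hs
  have v13 : A + e₁ ^ 2 + e₁ * e₃ + e₃ ^ 2 = 0 := by rw [hA]; linear_combination (e₁ + e₃) * hs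
  have v23 : A + e₂ ^ 2 + e₂ * e₃ + e₃ ^ 2 = 0 := by rw [hA]; linear_combination (e₂ + e₃) * hs
  have d1 : A + e₁ ^ 2 + e₁ * e₁ + e₁ ^ 2 = 3 * e₁ ^ 2 + A := by ring
  have d2 : A + e₂ ^ 2 + e₂ * e₂ + e₂ ^ 2 = 3 * e₂ ^ 2 + A := by ring
  have d3 : A + e₃ ^ 2 + e₃ * e₃ + e₃ ^ 2 = 3 * e₃ ^ 2 + A := by ring
  refine ⟨?_, ?_, ?_⟩ <;> rw [key]
  · rw [d1, show A + e₂ ^ 2 + e₂ * e₁ + e₁ ^ 2 = 0 by linear_combination v12,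
      show A + e₃ ^ 2 + e₃ * e₁ + e₁ ^ 2 = 0 by linear_combination v13, mul_zero, mul_zero, zero_div, zero_div,
      add_zero, add_zero, mul_div_assoc, div_self hF1, mul_one]
  · rw [d2, v12, show A + e₃ ^ 2 + e₃ * e₂ + e₂ ^ 2 = 0 by linear_combination v23, mul_zero, mul_zero, zero_div,
      zero_div, add_zero, zero_add, mul_div_assoc, div_self hF2, mul_one]
  · rw [d3, v13, v23, mul_zero, mul_zero, zero_div, zero_div, zero_add, zero_add, mul_div_assoc, div_self hF3,
      mul_one]

end Lagrange

/-! ## §2 Short-model helpers -/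

section ShortHelpers

variable {F : Type*} [Field F] {C : Affine F} {A B : F} (hC : IsShortModel C A B)
include hC

/-- On the short model, a solution of `y² = x³ + Ax + B` with `y ≠ 0` (and `2 ≠ 0`) is a
nonsingular point. [folklore] -/
theorem IsShortModel.nonsingular_of_y_ne {x y : F} (h2 : (2 : F) ≠ 0) (hy : y ≠ 0)
    (heq : y ^ 2 = x ^ 3 + A * x + B) : C.Nonsingular x y := by
  rw [Affine.nonsingular_iff', hC.a₁, hC.a₃]
  refine ⟨(hC.equation_iff x y).mpr heq, Or.inr ?_⟩
  rw [zero_mul, add_zero, add_zero]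
  exact mul_ne_zero h2 hy

/-- On the short model, an affine point with `y = 0` is `2`-torsion. [folklore] -/
theorem IsShortModel.add_self_of_y_eq_zero {x : F} (h : C.Nonsingular x 0) :
    Point.some x 0 h + Point.some x 0 h = 0 := by
  apply Point.add_self_of_Y_eq
  rw [hC.negY, neg_zero]

end ShortHelpers

/-! ## §3 The local picture at a `ℚ`-field `E` -/

section Local

variable {AB : ℤ × ℤ} (hE : 4 * AB.1 ^ 3 + 27 * AB.2 ^ 2 ≠ 0)
  (φ : contOneCocycles (discreteTopRep (Field.absoluteGaloisGroup ℚ) (geomTorsion (shortWeierstrass AB) 2)))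
  (E : Type) [Field E] [Algebra ℚ E]

/-- The chosen embedding `ι : ℚ̄ → Ē`, as a ring homomorphism. [folklore] -/
abbrev iotaE : AlgebraicClosure ℚ →+* AlgebraicClosure E := (closureEmb (K := ℚ) E : AlgebraicClosure ℚ →ₐ[ℚ] _)

/-- An element of `Γ_E` as a `ℚ`-algebra automorphism of `Ē` (restriction of scalars). [folklore] -/
abbrev galE (σ : Field.absoluteGaloisGroup E) : AlgebraicClosure E ≃ₐ[ℚ] AlgebraicClosure E :=
  AlgEquiv.restrictScalars ℚ (show AlgebraicClosure E ≃ₐ[E] AlgebraicClosure E from σ)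

/-- `ι` intertwines `resGal` and `Γ_E`: `galE σ (ι x) = ι (gal (resGal σ) x)`. [folklore] -/
theorem galE_iotaE (σ : Field.absoluteGaloisGroup E) (x : AlgebraicClosure ℚ) :
    galE E σ (iotaE E x) = iotaE E (gal (resGal (K := ℚ) E σ) x) :=
  (apply_resGalAuxOfEmb_apply (closureEmb (K := ℚ) E) σ x).symm

/-- `galE σ` fixes `algebraMap ℚ Ē`. [folklore] -/
theorem galE_algebraMap (σ : Field.absoluteGaloisGroup E) (q : ℚ) :
    galE E σ (algebraMap ℚ (AlgebraicClosure E) q) = algebraMap ℚ (AlgebraicClosure E) q :=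
  AlgEquiv.commutes _ q

/-- `galE σ` fixes `algebraMap E Ē`. [folklore] -/
theorem galE_algebraMap' (σ : Field.absoluteGaloisGroup E) (x : E) :
    galE E σ (algebraMap E (AlgebraicClosure E) x) = algebraMap E (AlgebraicClosure E) x :=
  AlgEquiv.commutes (show AlgebraicClosure E ≃ₐ[E] AlgebraicClosure E from σ) x

/-- The action of `Γ_E` on `E(Ē)` is `Point.map (galE σ)`. [folklore] -/
theorem localPoints_smul_eq (σ : Field.absoluteGaloisGroup E) (P : localPoints (shortWeierstrass AB) E) :
    σ • P = Point.map (galE E σ : AlgebraicClosure E →ₐ[ℚ] AlgebraicClosure E) P :=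
  rfl

/-- The bootstrap form over `Ē`. [folklore] -/
abbrev bootFormE : BinaryQuartic (AlgebraicClosure E) :=
  ((bootForm AB).map (algebraMap ℚ (AlgebraicClosure ℚ))).map (iotaE E)

/-- The bootstrap root data over `Ē`. [folklore] -/
abbrev bootDataE : RootData (bootFormE (AB := AB) E) := (bootData (Ω := AlgebraicClosure ℚ) hE).map (iotaE E)

include hE in
/-- The bootstrap form over `Ē` is in the `E_{A,B}`-family (`t = 2`). [folklore] -/
theorem setup_bootFormE : Setup (bootFormE (AB := AB) E) (algebraMap ℚ (AlgebraicClosure E) (AB.1 : ℚ))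
    (algebraMap ℚ (AlgebraicClosure E) (AB.2 : ℚ)) (algebraMap ℚ (AlgebraicClosure E) 2) := by
  have h := (setup_bootForm_map hE).map (iotaE E)
  have e : ∀ q : ℚ, (iotaE E) (algebraMap ℚ (AlgebraicClosure ℚ) q) = algebraMap ℚ (AlgebraicClosure E) q :=
    fun q ↦ (closureEmb (K := ℚ) E).commutes q
  rw [e, e, e] at h
  exact h

/-- `3 ≠ 0` in `Ē` (a `ℚ`-algebra). [folklore] -/
theorem three_ne_zero_E : (3 : AlgebraicClosure E) ≠ 0 := by
  have h := (map_ne_zero (algebraMap ℚ (AlgebraicClosure E))).mpr (show (3 : ℚ) ≠ 0 by norm_num)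
  rwa [map_ofNat] at h

/-- `2 ≠ 0` in `Ē` (a `ℚ`-algebra). [folklore] -/
theorem two_ne_zero_E : (2 : AlgebraicClosure E) ≠ 0 := by
  have h := (map_ne_zero (algebraMap ℚ (AlgebraicClosure E))).mpr (show (2 : ℚ) ≠ 0 by norm_num)
  rwa [map_ofNat] at h

include hE in
/-- `Δ(f₀) ≠ 0` over `Ē`. [folklore] -/
theorem disc_bootFormE_ne_zero : (bootFormE (AB := AB) E).disc ≠ 0 :=
  (setup_bootFormE hE E).disc_ne_zero_of_ne (twentySeven_ne_zero (three_ne_zero_E E))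

/-- **The local torsors** `Tloc k = T(ι r₀, ι r_k) ∈ E_{A,B}(Ē)`. [folklore] -/
def Tloc (k : Fin 4) : ((shortWeierstrass AB).baseChange (AlgebraicClosure E)).toAffine.Point :=
  torsorPt ((shortWeierstrass AB).baseChange (AlgebraicClosure E)).toAffine (bootFormE (AB := AB) E)
    (algebraMap ℚ (AlgebraicClosure E) 2) ((bootDataE hE E).r 0) ((bootDataE hE E).r k)

/-- The global torsors map to the local ones: `ι_* (Tb k) = Tloc k`. [folklore] -/
theorem pointsMap_Tb (k : Fin 4) : pointsMap (shortWeierstrass AB) E (Tb hE k) = Tloc hE E k := by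
  change Point.map (closureEmb (K := ℚ) E) (torsorPt _ _ _ _ _) = _
  rw [map_torsorPt]
  rw [Tloc]
  congr 1
  simp [map_ofNat]

/-- `Tloc 0 = O`. [folklore] -/
theorem Tloc_zero : Tloc hE E 0 = 0 := torsorPt_self _ _ _

/-- The local roots of the cubic `e′ᵢ = ι(eᵢ)`. [folklore] -/
def ebE (k : Fin 4) : AlgebraicClosure E := iotaE E (eb hE k)

/-- The torsion abscissae over `Ē` are the `e′ᵢ`. [folklore] -/
theorem torsX_bootDataE (k : Fin 4) : torsX (bootFormE (AB := AB) E) (algebraMap ℚ (AlgebraicClosure E) 2)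
    ((bootDataE hE E).r 0) ((bootDataE hE E).r k) = ebE hE E k := by
  rw [ebE, eb, ← torsX_map (iotaE E)]
  simp [map_ofNat]

/-- For `k ≠ 0`, `Tloc k` is the `2`-torsion point `(e′_k, 0)`. [folklore] -/
theorem Tloc_eq_some {k : Fin 4} (hk : k ≠ 0) :
    ∃ h, Tloc hE E k = Point.some (ebE hE E k) 0 h := by
  have hs := setup_bootFormE hE E
  have h := torsorPt_eq_some (isShortModel_ratCast AB _) (bootDataE hE E) hs.a_ne (three_ne_zero_E E)
    (disc_bootFormE_ne_zero hE E) hs.t_ne hs.I_eq hs.J_eq (Ne.symm hk)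
  rw [Tloc, h]
  refine ⟨?_, ?_⟩
  · rw [← torsX_bootDataE]; exact nonsingular_torsX (isShortModel_ratCast AB _) (bootDataE hE E) hs.a_ne
      (three_ne_zero_E E) (disc_bootFormE_ne_zero hE E) hs.t_ne hs.I_eq hs.J_eq (Ne.symm hk)
  · congr 1; exact torsX_bootDataE hE E k

/-- `e′_k` is a root of the cubic (`k ≠ 0`). [folklore] -/
theorem ebE_cubic {k : Fin 4} (hk : k ≠ 0) :
    ebE hE E k ^ 3 + algebraMap ℚ (AlgebraicClosure E) (AB.1 : ℚ) * ebE hE E k +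
      algebraMap ℚ (AlgebraicClosure E) (AB.2 : ℚ) = 0 := by
  have h := congrArg (iotaE E) (eb_cubic hE hk)
  simpa [ebE] using h

/-- Vieta for the `e′ᵢ`. [folklore] -/
theorem ebE_vieta : ebE hE E 1 + ebE hE E 2 + ebE hE E 3 = 0 ∧
    ebE hE E 1 * ebE hE E 2 + ebE hE E 1 * ebE hE E 3 + ebE hE E 2 * ebE hE E 3 =
      algebraMap ℚ (AlgebraicClosure E) (AB.1 : ℚ) := by
  obtain ⟨h1, h2, -⟩ := eb_vieta hE
  refine ⟨by simpa [ebE] using congrArg (iotaE E) h1, ?_⟩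
  have h := congrArg (iotaE E) h2
  simpa [ebE] using h

/-- Vieta for the `e′ᵢ` in any order of the three nonzero indices. [folklore] -/
theorem ebE_vieta_perm {i j m : Fin 4} (hi : i ≠ 0) (hj : j ≠ 0) (hm : m ≠ 0) (hij : i ≠ j) (him : i ≠ m)
    (hjm : j ≠ m) : ebE hE E i + ebE hE E j + ebE hE E m = 0 ∧
    ebE hE E i * ebE hE E j + ebE hE E i * ebE hE E m + ebE hE E j * ebE hE E m =
      algebraMap ℚ (AlgebraicClosure E) (AB.1 : ℚ) := by
  obtain ⟨hs, hA⟩ := ebE_vieta hE E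
  have hi' : i = 1 ∨ i = 2 ∨ i = 3 := by clear hij him; revert i; decide
  have hj' : j = 1 ∨ j = 2 ∨ j = 3 := by clear hij hjm; revert j; decide
  have hm' : m = 1 ∨ m = 2 ∨ m = 3 := by clear him hjm; revert m; decide
  rcases hi' with rfl | rfl | rfl <;> rcases hj' with rfl | rfl | rfl <;> rcases hm' with rfl | rfl | rfl <;> first
    | exact absurd rfl hij
    | exact absurd rfl him
    | exact absurd rfl hjm
    | exact ⟨by linear_combination hs, by linear_combination hA⟩

/-- The `e′ᵢ` (`i ≠ 0`) are distinct. [folklore] -/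
theorem ebE_injective {k l : Fin 4} (hk : k ≠ 0) (hl : l ≠ 0) (h : ebE hE E k = ebE hE E l) : k = l :=
  eb_injective hE hk hl ((iotaE E).injective h)

/-- `F′(e′ᵢ) ≠ 0`. [folklore] -/
theorem deriv_ebE_ne_zero {i : Fin 4} (hi : i ≠ 0) :
    3 * ebE hE E i ^ 2 + algebraMap ℚ (AlgebraicClosure E) (AB.1 : ℚ) ≠ 0 := by
  have h := (map_ne_zero (iotaE E)).mpr (deriv_eb_ne_zero hE hi)
  simpa [ebE, map_ofNat] using h

/-- Galois moves the `e′ᵢ` by the root permutation of `resGal σ`. [folklore] -/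
theorem galE_ebE (σ : Field.absoluteGaloisGroup E) (k : Fin 4) :
    galE E σ (ebE hE E k) = ebE hE E (rootPerm hE (resGal (K := ℚ) E σ) k) := by
  rw [ebE, galE_iotaE, gal_eb]; rfl

/-- The local twisted invariant `w′ = ι(w)`. [folklore] -/
def wE (j : Fin 4) : AlgebraicClosure E := iotaE E (twInv hE φ j)

/-- `w′ⱼ ≠ 0` for `j ≠ 0`. [folklore] -/
theorem wE_ne_zero {j : Fin 4} (hj : j ≠ 0) : wE hE φ E j ≠ 0 :=
  (map_ne_zero (iotaE E)).mpr (twInv_ne_zero hE φ hj)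

/-- **Transformation law of `w′`** under `Γ_E`: `σ(w′ⱼ) = sgn (idx (resGal σ)) (κⱼ) · w′_{κⱼ}`. [folklore] -/
theorem galE_wE (σ : Field.absoluteGaloisGroup E) (j : Fin 4) :
    galE E σ (wE hE φ E j) = (sgn (idx hE φ (resGal (K := ℚ) E σ)) (rootPerm hE (resGal (K := ℚ) E σ) j) :
      AlgebraicClosure E) * wE hE φ E (rootPerm hE (resGal (K := ℚ) E σ) j) := by
  rw [wE, galE_iotaE]
  have h := gal_twInv hE φ (resGal (K := ℚ) E σ) (rootPerm hE (resGal (K := ℚ) E σ) j)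
  rw [Equiv.Perm.inv_def, Equiv.symm_apply_apply] at h
  rw [h, map_mul, map_intCast, wE]

/-- The local `δ′ = ι(δ) = w′²`. [folklore] -/
theorem iotaE_delta (j : Fin 4) : iotaE E (delta hE φ j) = wE hE φ E j ^ 2 := by
  rw [delta, map_pow, wE]

/-- **The local point.** If the class of `φ` satisfies the local condition at `E`, there is
`P ∈ E_{A,B}(Ē)` with `σP = P + Tloc (idx (resGal σ))` for all `σ ∈ Γ_E` (cocycle criterion for the
restriction kernel, Serre I.§5.1, and `ι_*(φ(σ|)) = Tloc`). [cite: Cremona2001, §5 (cocycles trivial in H¹(Gal(K̄/K), E) as coboundaries Q^σ − Q)] -/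
theorem exists_localPt (hmem : oneCocycleClass _ φ ∈ selmerLocalKer (shortWeierstrass AB) E 2) :
    ∃ P : ((shortWeierstrass AB).baseChange (AlgebraicClosure E)).toAffine.Point,
      ∀ σ : Field.absoluteGaloisGroup E,
        Point.map (galE E σ : AlgebraicClosure E →ₐ[ℚ] AlgebraicClosure E) P =
          P + Tloc hE E (idx hE φ (resGal (K := ℚ) E σ)) := by
  rw [selmerLocalKer, oneCocycleClass_mem_resKer_iff] at hmem
  obtain ⟨P, hP⟩ := hmem
  refine ⟨P, fun σ ↦ ?_⟩
  have h := hP σ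
  rw [AddMonoidHom.comp_apply, AddSubgroup.coe_subtype, idx_spec hE φ, pointsMap_Tb] at h
  have h' : σ • P = P + (show localPoints (shortWeierstrass AB) E from Tloc hE E (idx hE φ (resGal (K := ℚ) E σ))) := by
    rw [add_comm]; exact (eq_sub_iff_add_eq.mp h).symm
  exact h'

end Local

/-! ## §4 The transformation laws under `Γ_E` -/

section Laws

/-- `gfun` is a rational function: it commutes with field homomorphisms. [folklore] -/
theorem map_gfun {F S : Type*} [Field F] [Field S] (ψ : F →+* S) (A e x y : F) :
    ψ (gfun A e x y) = gfun (ψ A) (ψ e) (ψ x) (ψ y) := by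
  simp [gfun, map_ofNat]

/-- The cast of a sign is nonzero (in a field where `−1 ≠ 0`, i.e. any field). [folklore] -/
theorem sgn_cast_ne_zero {F : Type*} [Field F] (k i : Fin 4) : (sgn k i : F) ≠ 0 := by
  unfold sgn; split_ifs <;> simp

variable {AB : ℤ × ℤ} (hE : 4 * AB.1 ^ 3 + 27 * AB.2 ^ 2 ≠ 0)
  (φ : contOneCocycles (discreteTopRep (Field.absoluteGaloisGroup ℚ) (geomTorsion (shortWeierstrass AB) 2)))
  (E : Type) [Field E] [Algebra ℚ E]

/-- A point `(x, y)` with `y ≠ 0` on `E_{A,B} ⁄ Ē` has `x ≠ e′_k`. [folklore] -/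
theorem x_ne_ebE {x y : AlgebraicClosure E}
    (hxy : ((shortWeierstrass AB).baseChange (AlgebraicClosure E)).toAffine.Nonsingular x y) (hy : y ≠ 0)
    {k : Fin 4} (hk : k ≠ 0) : x ≠ ebE hE E k := by
  intro hx
  have heq := ((isShortModel_ratCast AB (AlgebraicClosure E)).equation_iff x y).mp hxy.1
  rw [hx, ebE_cubic hE E hk] at heq
  exact hy (pow_eq_zero_iff two_ne_zero |>.mp heq)

/-- **Transformation law of the descent values** `u′ᵢ = gᵢ(P′)`: if `σP′ = P′ + Tloc (idx σ|)` for all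
`σ ∈ Γ_E` (`P′ = (x, y)`, `y ≠ 0`), then `σ(u′ᵢ) = sgn (idx σ|) (κᵢ) · u′_{κᵢ}` — the same law as
for `w′` (`galE_wE`). [folklore] -/
theorem galE_gfun {x y : AlgebraicClosure E}
    (hxy : ((shortWeierstrass AB).baseChange (AlgebraicClosure E)).toAffine.Nonsingular x y) (hy : y ≠ 0)
    (hrel : ∀ σ : Field.absoluteGaloisGroup E,
      Point.map (galE E σ : AlgebraicClosure E →ₐ[ℚ] AlgebraicClosure E) (Point.some x y hxy) =
        Point.some x y hxy + Tloc hE E (idx hE φ (resGal (K := ℚ) E σ)))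
    (σ : Field.absoluteGaloisGroup E) {i : Fin 4} (hi : i ≠ 0) :
    galE E σ (gfun (algebraMap ℚ (AlgebraicClosure E) (AB.1 : ℚ)) (ebE hE E i) x y) =
      (sgn (idx hE φ (resGal (K := ℚ) E σ)) (rootPerm hE (resGal (K := ℚ) E σ) i) : AlgebraicClosure E) *
        gfun (algebraMap ℚ (AlgebraicClosure E) (AB.1 : ℚ)) (ebE hE E (rootPerm hE (resGal (K := ℚ) E σ) i)) x y := by
  have hC := isShortModel_ratCast AB (AlgebraicClosure E)
  have h2 := two_ne_zero_E E
  have hP := hrel σ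
  rw [Point.map_some] at hP
  simp only [AlgEquiv.coe_toAlgHom] at hP
  have hκi : rootPerm hE (resGal (K := ℚ) E σ) i ≠ 0 := fun h ↦ hi (by
    rw [← rootPerm_zero hE (resGal (K := ℚ) E σ)] at h
    exact (rootPerm hE _).injective h)
  have hmap : galE E σ (gfun (algebraMap ℚ (AlgebraicClosure E) (AB.1 : ℚ)) (ebE hE E i) x y) =
      gfun (algebraMap ℚ (AlgebraicClosure E) (AB.1 : ℚ)) (ebE hE E (rootPerm hE (resGal (K := ℚ) E σ) i))
        (galE E σ x) (galE E σ y) := by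
    have h := map_gfun ((galE E σ : AlgebraicClosure E →ₐ[ℚ] AlgebraicClosure E) : AlgebraicClosure E →+* AlgebraicClosure E)
      (algebraMap ℚ (AlgebraicClosure E) (AB.1 : ℚ)) (ebE hE E i) x y
    simp only [AlgHom.coe_toRingHom, AlgEquiv.coe_toAlgHom] at h
    rw [h, galE_algebraMap, galE_ebE]
  rw [hmap]
  by_cases hk0 : idx hE φ (resGal (K := ℚ) E σ) = 0
  · rw [hk0, Tloc_zero, add_zero] at hP
    simp only [Point.some.injEq] at hP
    rw [hP.1, hP.2, hk0]
    simp [sgn]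
  · obtain ⟨hT, hTeq⟩ := Tloc_eq_some hE E hk0
    have hxe : x ≠ ebE hE E (idx hE φ (resGal (K := ℚ) E σ)) := x_ne_ebE hE E hxy hy hk0
    obtain ⟨h3, hadd⟩ := some_add_torsion hC hxy hT hxe
    rw [hTeq, hadd] at hP
    simp only [Point.some.injEq] at hP
    rw [hP.1, hP.2]
    have hx : x - ebE hE E (idx hE φ (resGal (K := ℚ) E σ)) ≠ 0 := sub_ne_zero.mpr hxe
    by_cases hik : rootPerm hE (resGal (K := ℚ) E σ) i = idx hE φ (resGal (K := ℚ) E σ)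
    · rw [hik, gfun_mobT_self h2 hy hx (deriv_ebE_ne_zero hE E hk0)]
      simp [sgn]
    · -- the third index and Vieta in the order `(κ i, k, m)`
      obtain ⟨hm0, hmi, hmk⟩ := v4add_ne hκi hk0 hik
      obtain ⟨hs, hA2⟩ := ebE_vieta_perm hE E hκi hk0 hm0 hik (Ne.symm hmi) (Ne.symm hmk)
      have hA := A_eq_of_vieta hs hA2
      have hee : ebE hE E (rootPerm hE (resGal (K := ℚ) E σ) i) - ebE hE E (idx hE φ (resGal (K := ℚ) E σ)) ≠ 0 :=
        sub_ne_zero.mpr fun h ↦ hik (ebE_injective hE E hκi hk0 h)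
      have hee' : 2 * ebE hE E (idx hE φ (resGal (K := ℚ) E σ)) + ebE hE E (rootPerm hE (resGal (K := ℚ) E σ) i) ≠ 0 := by
        intro h0
        have : ebE hE E (idx hE φ (resGal (K := ℚ) E σ)) =
            ebE hE E (v4add (rootPerm hE (resGal (K := ℚ) E σ) i) (idx hE φ (resGal (K := ℚ) E σ))) := by
          linear_combination h0 - hs
        exact hmk.symm (ebE_injective hE E hk0 hm0 this)
      rw [gfun_mobT_other h2 hy hx hee hee' hA]
      have hsgn : sgn (idx hE φ (resGal (K := ℚ) E σ)) (rootPerm hE (resGal (K := ℚ) E σ) i) = -1 := by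
        unfold sgn; rw [if_neg]; push Not; exact ⟨hκi, hk0, fun h ↦ hik h.symm⟩
      rw [hsgn]; simp

/-- **The ratios are plainly equivariant**: `ρⱼ = u′ⱼ / w′ⱼ` satisfies `σ(ρⱼ) = ρ_{κⱼ}`. [folklore] -/
theorem galE_ratio {x y : AlgebraicClosure E}
    (hxy : ((shortWeierstrass AB).baseChange (AlgebraicClosure E)).toAffine.Nonsingular x y) (hy : y ≠ 0)
    (hrel : ∀ σ : Field.absoluteGaloisGroup E,
      Point.map (galE E σ : AlgebraicClosure E →ₐ[ℚ] AlgebraicClosure E) (Point.some x y hxy) =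
        Point.some x y hxy + Tloc hE E (idx hE φ (resGal (K := ℚ) E σ)))
    (σ : Field.absoluteGaloisGroup E) {j : Fin 4} (hj : j ≠ 0) :
    galE E σ (gfun (algebraMap ℚ (AlgebraicClosure E) (AB.1 : ℚ)) (ebE hE E j) x y / wE hE φ E j) =
      gfun (algebraMap ℚ (AlgebraicClosure E) (AB.1 : ℚ)) (ebE hE E (rootPerm hE (resGal (K := ℚ) E σ) j)) x y /
        wE hE φ E (rootPerm hE (resGal (K := ℚ) E σ) j) := by
  rw [map_div₀, galE_gfun hE φ E hxy hy hrel σ hj, galE_wE, mul_div_mul_left _ _ (sgn_cast_ne_zero _ _)]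

end Laws

/-! ## §5 The `E`-rational isotropic vector -/

section Isotropy

variable {AB : ℤ × ℤ} (hE : 4 * AB.1 ^ 3 + 27 * AB.2 ^ 2 ≠ 0)
  (φ : contOneCocycles (discreteTopRep (Field.absoluteGaloisGroup ℚ) (geomTorsion (shortWeierstrass AB) 2)))
  (E : Type) [Field E] [Algebra ℚ E]

/-- Elements of `Ē` fixed by `Γ_E` lie in `E` (characteristic `0` obtained from the `ℚ`-algebra
structure; kept out of the ambient instances on purpose). [folklore] -/
theorem exists_algebraMap_eq_of_galE_fixed (z : AlgebraicClosure E)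
    (hz : ∀ σ : Field.absoluteGaloisGroup E, galE E σ z = z) : ∃ v : E, algebraMap E (AlgebraicClosure E) v = z := by
  haveI : CharZero E := charZero_of_injective_algebraMap (algebraMap ℚ E).injective
  exact exists_algebraMap_eq_of_fixed E z hz

/-- **A good local point.** From the local condition and five `E`-rational affine points with
distinct abscissae and `y ≠ 0`, there is `P′ = (x, y) ∈ E_{A,B}(Ē)` with `y ≠ 0` and
`σP′ = P′ + Tloc (idx σ|)` for all `σ ∈ Γ_E` (translate the local point by a rational point avoiding
`O` and `E[2]`). [folklore] -/
theorem exists_good_localPt (hmem : oneCocycleClass _ φ ∈ selmerLocalKer (shortWeierstrass AB) E 2)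
    (hpts : ∃ xs : Fin 5 → E, Function.Injective xs ∧ ∀ i, ∃ y : E, y ≠ 0 ∧
      y ^ 2 = xs i ^ 3 + algebraMap ℚ E (AB.1 : ℚ) * xs i + algebraMap ℚ E (AB.2 : ℚ)) :
    ∃ (x y : AlgebraicClosure E) (hxy : ((shortWeierstrass AB).baseChange (AlgebraicClosure E)).toAffine.Nonsingular x y),
      y ≠ 0 ∧ ∀ σ : Field.absoluteGaloisGroup E,
        Point.map (galE E σ : AlgebraicClosure E →ₐ[ℚ] AlgebraicClosure E) (Point.some x y hxy) =
          Point.some x y hxy + Tloc hE E (idx hE φ (resGal (K := ℚ) E σ)) := by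
  have hC := isShortModel_ratCast AB (AlgebraicClosure E)
  have h2 := two_ne_zero_E E
  obtain ⟨P, hP⟩ := exists_localPt hE φ E hmem
  obtain ⟨xs, hinj, hys⟩ := hpts
  choose ys hy0 hyeq using hys
  have htower : ∀ q : ℚ, algebraMap E (AlgebraicClosure E) (algebraMap ℚ E q) = algebraMap ℚ (AlgebraicClosure E) q :=
    fun q ↦ (IsScalarTower.algebraMap_apply ℚ E (AlgebraicClosure E) q).symm
  have hns : ∀ i, ((shortWeierstrass AB).baseChange (AlgebraicClosure E)).toAffine.Nonsingular
      (algebraMap E (AlgebraicClosure E) (xs i)) (algebraMap E (AlgebraicClosure E) (ys i)) := fun i ↦ by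
    refine hC.nonsingular_of_y_ne h2 ((map_ne_zero _).mpr (hy0 i)) ?_
    have h := congrArg (algebraMap E (AlgebraicClosure E)) (hyeq i)
    simp only [map_pow, map_add, map_mul, htower] at h
    exact h
  let Q : Fin 5 → ((shortWeierstrass AB).baseChange (AlgebraicClosure E)).toAffine.Point :=
    fun i ↦ Point.some _ _ (hns i)
  have hQfix : ∀ (σ : Field.absoluteGaloisGroup E) (i : Fin 5),
      Point.map (galE E σ : AlgebraicClosure E →ₐ[ℚ] AlgebraicClosure E) (Q i) = Q i := by
    intro σ i
    simp only [Q, Point.map_some, AlgEquiv.coe_toAlgHom, galE_algebraMap']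
  have hQinj : Function.Injective Q := by
    intro i j hij
    simp only [Q, Point.some.injEq] at hij
    exact hinj ((algebraMap E (AlgebraicClosure E)).injective hij.1)
  have hPi : ∀ (i : Fin 5) (σ : Field.absoluteGaloisGroup E),
      Point.map (galE E σ : AlgebraicClosure E →ₐ[ℚ] AlgebraicClosure E) (P + Q i) =
        (P + Q i) + Tloc hE E (idx hE φ (resGal (K := ℚ) E σ)) := by
    intro i σ
    rw [map_add, hP σ, hQfix σ i]
    abel
  -- a good index exists
  have hgood : ∃ i : Fin 5, P + Q i ≠ 0 ∧ ∀ k : Fin 4, k ≠ 0 → P + Q i ≠ Tloc hE E k := by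
    by_contra hall
    push Not at hall
    have hk : ∀ i : Fin 5, ∃ k : Fin 4, P + Q i = Tloc hE E k := by
      intro i
      by_cases h0 : P + Q i = 0
      · exact ⟨0, by rw [h0, Tloc_zero]⟩
      · obtain ⟨k, -, hk⟩ := hall i h0
        exact ⟨k, hk⟩
    choose g hg using hk
    have hginj : Function.Injective g := by
      intro i j hij
      apply hQinj
      have h := hg i
      rw [hij, ← hg j] at h
      exact add_left_cancel h
    have := Fintype.card_le_of_injective g hginj
    simp at this
  obtain ⟨i, hne, hnot⟩ := hgood
  -- the good point is affine with `y ≠ 0`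
  have hsetup := setup_bootFormE hE E
  obtain ⟨x, y, hxy, hPeq⟩ : ∃ x y h, P + Q i = Point.some x y h := by
    rcases hP' : P + Q i with _ | ⟨x, y, h⟩
    · exact absurd hP' hne
    · exact ⟨x, y, h, rfl⟩
  refine ⟨x, y, hxy, ?_, fun σ ↦ by rw [← hPeq]; exact hPi i σ⟩
  rintro rfl
  have h2t : Point.some x 0 hxy + Point.some x 0 hxy = 0 := hC.add_self_of_y_eq_zero hxy
  obtain ⟨k, hk⟩ := exists_eq_torsorPt (bootDataE hE E) hC h2 hsetup.a_ne (three_ne_zero_E E)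
    (disc_bootFormE_ne_zero hE E) hsetup.t_ne hsetup.I_eq hsetup.J_eq _ h2t
  rw [← hPeq] at hk
  by_cases hk0 : k = 0
  · rw [hk0] at hk; exact hne (hk.trans (Tloc_zero hE E))
  · exact hnot k hk0 hk

/-- The Lagrange-type sums `Σ_{j ≠ 0} ρⱼ gⱼ / F′(e′ⱼ)`. [folklore] -/
def lsum (ρ g : Fin 4 → AlgebraicClosure E) : AlgebraicClosure E :=
  ∑ j : Fin 4, if j = 0 then 0 else ρ j * g j / (3 * ebE hE E j ^ 2 + algebraMap ℚ (AlgebraicClosure E) (AB.1 : ℚ))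

/-- Unfolding `lsum` into three terms. [folklore] -/
theorem lsum_eq (ρ g : Fin 4 → AlgebraicClosure E) : lsum hE E ρ g =
    ρ 1 * g 1 / (3 * ebE hE E 1 ^ 2 + algebraMap ℚ (AlgebraicClosure E) (AB.1 : ℚ)) +
    ρ 2 * g 2 / (3 * ebE hE E 2 ^ 2 + algebraMap ℚ (AlgebraicClosure E) (AB.1 : ℚ)) +
    ρ 3 * g 3 / (3 * ebE hE E 3 ^ 2 + algebraMap ℚ (AlgebraicClosure E) (AB.1 : ℚ)) := by
  rw [lsum, Fin.sum_univ_four]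
  simp only [Fin.isValue, if_true, one_ne_zero, if_false, show (2 : Fin 4) ≠ 0 by decide,
    show (3 : Fin 4) ≠ 0 by decide, zero_add]

/-- **Equivariant sums are fixed**: if `σ(ρⱼ) = ρ_{κⱼ}` (`j ≠ 0`) and `σ(gⱼ) = g_{κⱼ}` then
`σ (lsum ρ g) = lsum ρ g`. [folklore] -/
theorem galE_lsum (σ : Field.absoluteGaloisGroup E) (ρ g : Fin 4 → AlgebraicClosure E)
    (hρ : ∀ j, j ≠ 0 → galE E σ (ρ j) = ρ (rootPerm hE (resGal (K := ℚ) E σ) j))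
    (hg : ∀ j, galE E σ (g j) = g (rootPerm hE (resGal (K := ℚ) E σ) j)) :
    galE E σ (lsum hE E ρ g) = lsum hE E ρ g := by
  rw [lsum, map_sum]
  have h0 : ∀ j, rootPerm hE (resGal (K := ℚ) E σ) j = 0 ↔ j = 0 := fun j ↦ by
    constructor
    · intro h; rw [← rootPerm_zero hE (resGal (K := ℚ) E σ)] at h; exact (rootPerm hE _).injective h
    · rintro rfl; exact rootPerm_zero hE _
  have hterm : ∀ j, galE E σ (if j = 0 then 0 else ρ j * g j / (3 * ebE hE E j ^ 2 + algebraMap ℚ (AlgebraicClosure E) (AB.1 : ℚ))) =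
      (fun j ↦ if j = 0 then 0 else ρ j * g j / (3 * ebE hE E j ^ 2 + algebraMap ℚ (AlgebraicClosure E) (AB.1 : ℚ)))
        (rootPerm hE (resGal (K := ℚ) E σ) j) := by
    intro j
    by_cases hj : j = 0
    · simp only [hj, if_true, map_zero, (h0 0).mpr rfl]
    · simp only [hj, if_false, (h0 j).not.mpr hj]
      rw [map_div₀, map_mul, map_add, map_mul, map_pow, hρ j hj, hg j, galE_ebE, galE_algebraMap, map_ofNat]
  simp_rw [hterm]
  exact Equiv.sum_comp (rootPerm hE (resGal (K := ℚ) E σ))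
    (fun j ↦ if j = 0 then 0 else ρ j * g j / (3 * ebE hE E j ^ 2 + algebraMap ℚ (AlgebraicClosure E) (AB.1 : ℚ)))

/-- `ι ∘ algebraMap ℚ ℚ̄ = algebraMap ℚ Ē`. [folklore] -/
@[simp] theorem iotaE_algebraMap (q : ℚ) : iotaE E (algebraMap ℚ (AlgebraicClosure ℚ) q) = algebraMap ℚ (AlgebraicClosure E) q :=
  (closureEmb (K := ℚ) E).commutes q

/-- **Local isotropy of the conic.** If the class of `φ` satisfies the local condition at the
`ℚ`-field `E` and `E_{A,B}(E)` has five affine points with distinct abscissae and `y ≠ 0`, then the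
rational conic `q_φ` represents zero over `E` (Birch–Swinnerton-Dyer 1963, Lemma 1; Cremona 2001,
§5). [cite: Cremona2001, §5 (if ξ is trivial in H¹(Gal(K̄/K), E) the conic has a point)] -/
theorem representsZero_conicMat_local (hmem : oneCocycleClass _ φ ∈ selmerLocalKer (shortWeierstrass AB) E 2)
    (hpts : ∃ xs : Fin 5 → E, Function.Injective xs ∧ ∀ i, ∃ y : E, y ≠ 0 ∧
      y ^ 2 = xs i ^ 3 + algebraMap ℚ E (AB.1 : ℚ) * xs i + algebraMap ℚ E (AB.2 : ℚ)) :
    RepresentsZero ((conicMat hE φ).map (algebraMap ℚ E)) := by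
  have hC := isShortModel_ratCast AB (AlgebraicClosure E)
  have h2 := two_ne_zero_E E
  obtain ⟨x, y, hxy, hy, hrel⟩ := exists_good_localPt hE φ E hmem hpts
  -- the ratios `ρⱼ = u′ⱼ / w′ⱼ`
  let ρ : Fin 4 → AlgebraicClosure E := fun j ↦
    gfun (algebraMap ℚ (AlgebraicClosure E) (AB.1 : ℚ)) (ebE hE E j) x y / wE hE φ E j
  have hρ : ∀ (σ : Field.absoluteGaloisGroup E) (j : Fin 4), j ≠ 0 →
      galE E σ (ρ j) = ρ (rootPerm hE (resGal (K := ℚ) E σ) j) := fun σ j hj ↦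
    galE_ratio hE φ E hxy hy hrel σ hj
  -- the three Lagrange sums are `Γ_E`-fixed, hence rational over `E`
  have ha := fun σ ↦ galE_lsum hE E σ ρ (fun j ↦ algebraMap ℚ (AlgebraicClosure E) (AB.1 : ℚ) + ebE hE E j ^ 2) (hρ σ)
    (fun j ↦ by rw [map_add, map_pow, galE_algebraMap, galE_ebE])
  have hb := fun σ ↦ galE_lsum hE E σ ρ (fun j ↦ ebE hE E j) (hρ σ) (fun j ↦ by rw [galE_ebE])
  have hc := fun σ ↦ galE_lsum hE E σ ρ (fun _ ↦ (1 : AlgebraicClosure E)) (hρ σ) (fun j ↦ by rw [map_one])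
  obtain ⟨va, hva⟩ := exists_algebraMap_eq_of_galE_fixed E _ ha
  obtain ⟨vb, hvb⟩ := exists_algebraMap_eq_of_galE_fixed E _ hb
  obtain ⟨vc, hvc⟩ := exists_algebraMap_eq_of_galE_fixed E _ hc
  -- Vieta data and nonvanishing denominators
  obtain ⟨hs, hA⟩ := ebE_vieta hE E
  have h12 : ebE hE E 1 - ebE hE E 2 ≠ 0 := sub_ne_zero.mpr fun h ↦ by
    have := ebE_injective hE E (by decide) (by decide) h; exact absurd this (by decide)
  have h13 : ebE hE E 1 - ebE hE E 3 ≠ 0 := sub_ne_zero.mpr fun h ↦ by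
    have := ebE_injective hE E (by decide) (by decide) h; exact absurd this (by decide)
  have h23 : ebE hE E 2 - ebE hE E 3 ≠ 0 := sub_ne_zero.mpr fun h ↦ by
    have := ebE_injective hE E (by decide) (by decide) h; exact absurd this (by decide)
  have hlag := lagrange_interpolate (ρ₁ := ρ 1) (ρ₂ := ρ 2) (ρ₃ := ρ 3) hs hA.symm h12 h13 h23
  dsimp only at hlag
  rw [← lsum_eq hE E ρ (fun j ↦ algebraMap ℚ (AlgebraicClosure E) (AB.1 : ℚ) + ebE hE E j ^ 2),
    ← lsum_eq hE E ρ (fun j ↦ ebE hE E j)] at hlag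
  have hc' : ρ 1 / (3 * ebE hE E 1 ^ 2 + algebraMap ℚ (AlgebraicClosure E) (AB.1 : ℚ)) +
      ρ 2 / (3 * ebE hE E 2 ^ 2 + algebraMap ℚ (AlgebraicClosure E) (AB.1 : ℚ)) +
      ρ 3 / (3 * ebE hE E 3 ^ 2 + algebraMap ℚ (AlgebraicClosure E) (AB.1 : ℚ)) = lsum hE E ρ (fun _ ↦ 1) := by
    rw [lsum_eq]; simp only [mul_one]
  rw [hc', ← hva, ← hvb, ← hvc] at hlag
  obtain ⟨hl1, hl2, hl3⟩ := hlag
  -- the squares of the descent values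
  have hyeq : y ^ 2 = x ^ 3 + algebraMap ℚ (AlgebraicClosure E) (AB.1 : ℚ) * x + algebraMap ℚ (AlgebraicClosure E) (AB.2 : ℚ) :=
    (hC.equation_iff x y).mp hxy.1
  have hsq : ∀ j : Fin 4, j ≠ 0 → gfun (algebraMap ℚ (AlgebraicClosure E) (AB.1 : ℚ)) (ebE hE E j) x y ^ 2 =
      ((3 * x ^ 2 + algebraMap ℚ (AlgebraicClosure E) (AB.1 : ℚ)) / (2 * y)) ^ 2 - 2 * x - ebE hE E j :=
    fun j hj ↦ gfun_sq h2 hy hyeq (ebE_cubic hE E hj)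
  refine ⟨![va, vb, vc], ?_, ?_⟩
  · -- nonvanishing: otherwise all `ρⱼ = 0`, all `u′ⱼ = 0`, all `x(2P′) = e′ⱼ`
    intro hv
    have hva0 : va = 0 := by simpa using congrFun hv 0
    have hvb0 : vb = 0 := by simpa using congrFun hv 1
    have hvc0 : vc = 0 := by simpa using congrFun hv 2
    rw [hva0, hvb0, hvc0, map_zero, zero_mul, zero_mul, add_zero, add_zero] at hl1 hl2
    have hu1 : gfun (algebraMap ℚ (AlgebraicClosure E) (AB.1 : ℚ)) (ebE hE E 1) x y = 0 := by
      have h := hl1.symm; rwa [div_eq_zero_iff, or_iff_left (wE_ne_zero hE φ E (by decide))] at h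
    have hu2 : gfun (algebraMap ℚ (AlgebraicClosure E) (AB.1 : ℚ)) (ebE hE E 2) x y = 0 := by
      have h := hl2.symm; rwa [div_eq_zero_iff, or_iff_left (wE_ne_zero hE φ E (by decide))] at h
    have e1 := hsq 1 (by decide)
    have e2 := hsq 2 (by decide)
    rw [hu1] at e1
    rw [hu2] at e2
    apply h12
    linear_combination e1 - e2
  · -- isotropy, checked in `Ē`
    apply (algebraMap E (AlgebraicClosure E)).injective
    rw [map_zero, ← toBilin'_map_apply (algebraMap E (AlgebraicClosure E)), Matrix.map_map]
    have hmat : ((conicMat hE φ).map (⇑(algebraMap E (AlgebraicClosure E)) ∘ ⇑(algebraMap ℚ E))) =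
        Matrix.of fun a b : Fin 3 ↦ ∑ i : Fin 3,
          (wE hE φ E i.succ ^ 2 / (3 * ebE hE E i.succ ^ 2 + algebraMap ℚ (AlgebraicClosure E) (AB.1 : ℚ))) *
            ebE hE E i.succ ^ (a.1 + b.1) := by
      have hcomp : (⇑(algebraMap E (AlgebraicClosure E)) ∘ ⇑(algebraMap ℚ E)) = ⇑(iotaE E) ∘ ⇑(algebraMap ℚ (AlgebraicClosure ℚ)) := by
        funext q
        simp only [Function.comp_apply]
        rw [← IsScalarTower.algebraMap_apply]
        exact ((closureEmb (K := ℚ) E).commutes q).symm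
      rw [hcomp, ← Matrix.map_map, conicMat_map]
      ext a b
      simp only [Matrix.map_apply, Matrix.of_apply, map_sum, map_mul, map_div₀, map_pow, map_add, map_ofNat, iotaE_delta,
        iotaE_algebraMap]
      rfl
    rw [hmat, toBilin'_hankel]
    have hv : (⇑(algebraMap E (AlgebraicClosure E)) ∘ ![va, vb, vc]) = ![algebraMap E _ va, algebraMap E _ vb, algebraMap E _ vc] := by
      funext i; fin_cases i <;> rfl
    rw [hv]
    simp only [Fin.sum_univ_three, Matrix.cons_val_zero, Matrix.cons_val_one, Matrix.head_cons, Matrix.cons_val_two,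
      Matrix.tail_cons, Fin.succ_zero_eq_one, Fin.succ_one_eq_two, show Fin.succ (2 : Fin 3) = 3 by decide]
    rw [hl1, hl2, hl3]
    have hF1 := deriv_ebE_ne_zero hE E (i := 1) (by decide)
    have hF2 := deriv_ebE_ne_zero hE E (i := 2) (by decide)
    have hF3 := deriv_ebE_ne_zero hE E (i := 3) (by decide)
    have hw1 := wE_ne_zero hE φ E (j := 1) (by decide)
    have hw2 := wE_ne_zero hE φ E (j := 2) (by decide)
    have hw3 := wE_ne_zero hE φ E (j := 3) (by decide)
    have key : ∀ (j : Fin 4), j ≠ 0 → wE hE φ E j ≠ 0 →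
        wE hE φ E j ^ 2 / (3 * ebE hE E j ^ 2 + algebraMap ℚ (AlgebraicClosure E) (AB.1 : ℚ)) * ρ j ^ 2 =
          (((3 * x ^ 2 + algebraMap ℚ (AlgebraicClosure E) (AB.1 : ℚ)) / (2 * y)) ^ 2 - 2 * x - ebE hE E j) /
            (3 * ebE hE E j ^ 2 + algebraMap ℚ (AlgebraicClosure E) (AB.1 : ℚ)) := by
      intro j hj hw
      simp only [ρ]
      rw [div_pow, hsq j hj, div_mul_div_comm, mul_comm (wE hE φ E j ^ 2), mul_div_mul_right _ _ (pow_ne_zero _ hw)]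
    rw [key 1 (by decide) hw1, key 2 (by decide) hw2, key 3 (by decide) hw3]
    exact sum_sub_div_deriv_eq_zero hs hA.symm h12 h13 h23

end Isotropy

end TwoCovering

end Literature.NumberTheory.EllipticCurves
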